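/-
Copyright (c) 2026 the pub-hodgecm-mathlib formalisation cell (harness21).  Prover seat hodgecm-mathlib-F0P3b-p01 (g26); E1 keeper ∕ dealer F0P3a-p03 (g31) k23
«= cut + order» 2026-09-03T05:24:36Z on CENSUS-R68 v1 607db827 (E1 BRICK LEDGER row 68-B «THE INVOLUTION FROM THE DIRECT SUM»).
-/
import Mathlib.RepresentationTheory.Irreducible
import Mathlib.LinearAlgebra.Projection
import Mathlib.Algebra.Field.Basic
import HarnessLib

/-!
# Two inequivalent irreducible subrepresentations of a length-two representation: the direct sum, the involution `𝒜₀ = P_A − P_{A′}`, and `End_G = k·1 ⊕ k·𝒜₀`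

Generic representation theory (any field `k`, any group `G`; Mathlib only; THEOREMS ONLY — no definition, no instance, no named fact).  Namespace
`Literature.RepresentationTheory`.  Cell `pub/hodgecm-mathlib`, crux H413 = `stmt-HodgeConjecture-24833` (`--supports` lane, count-neutral helper); E1 BRICK LEDGER row 68-B
(census `F0/P3/F0P3b-p01/g26/r68/CENSUS-R68-K4primeUNR.v1.md` §3): the (J-data) of the K4′ SENTENCE ★ `F0P3cStCharTSK4PrimeSelfExtSplitSentence` (`A₀ ∈ End_G(I₀)`, `A₀|_A = 1`)
and the letters `hEnd ∕ hA₀sq ∕ hA₀ns` of the jet-intertwiner brick (O1), for `I₀ = i_B(θ̃) = π⁺ ⊕ π⁻` in case (3) of [Rogawski1990, §12.2] — the normalised Knapp–Stein involution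
read off the direct sum, no intertwining integral ([Keys1984, §4 Thm. 3]: `R ≅ ℤ∕2`).

THE MATHEMATICS.  `ρ` a representation of `G` on `V`, `A, A′ ≤ V` invariant submodules (`hA`, `hA'` in the `A ≤ A.comap (ρ g)` currency of the cell).
* §1 THE DIRECT SUM.  If `A` and `A′` are IRREDUCIBLE as invariant submodules (no invariant submodule strictly between `⊥` and them — the `hAirr` letter of the SENTENCE), non-zero
  and DISTINCT, then `A ⊓ A′ = ⊥`; if moreover `ρ` has no 3-chain of subrepresentations («length ≤ 2», the cell's `hlen`), then `A ⊔ A′ = ⊤`: `IsCompl A A′`.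
* §2 THE INVOLUTION.  For complementary invariant `A, A′`: `𝒜₀ := P_A − P_{A′}` (`P` the projections along the complement) commutes with `ρ`, is `+1` on `A`, `−1` on `A′`,
  `𝒜₀² = 1` — stated as `∃ A₀ : Module.End k V, …` (no definition); and the projection `P_A` commutes with `ρ` (`projection_comm_of_invariant`).
* §3 THE COMMUTANT.  If in addition `End_G(ρ|_A) = k` and `End_G(ρ|_{A′}) = k` (Schur, hypotheses `hSchurA hSchurA'`: every self-intertwiner is a scalar) and
  `Hom_G(ρ|_A, ρ|_{A′}) = 0 = Hom_G(ρ|_{A′}, ρ|_A)` (`hHom hHom'` — inequivalent irreducibles, §0), and `2 ≠ 0` in `k`, then every `T ∈ End_G(V)` is `a·1 + b·𝒜₀` for the involution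
  of §2 (characterised by `𝒜₀|_A = 1`, `𝒜₀|_{A′} = −1`); in particular `𝒜₀ ≠ ±1` when `A, A′ ≠ ⊥`.
* §0 `intertwiningMap_eq_zero_of_forall_equiv_false`: between irreducibles, no equivalence ⇒ every intertwiner is `0` (Mathlib `IsIrreducible.bijective_or_eq_zero`).
HONEST LABEL: count-neutral generic helper; nothing printed is asserted; h413 OPEN; HC_CM is proved only modulo the 7 printed citations (2 remaining named inputs hLiu418 =
stmt-HodgeConjecture-24832, h413 = stmt-HodgeConjecture-24833) until rung 0 closes.

## References
* [Rogawski1990] J. D. Rogawski, *Automorphic Representations of Unitary Groups in Three Variables*, Ann. of Math. Stud. 123 (1990), §12.2 (3) pp. 173–174.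
* [Keys1984] D. Keys, *Principal series representations of special unitary groups over local fields*, Compositio Math. 51 (1984), §4 Thm. 3 p. 120.
* [BushnellHenniart2006] C. J. Bushnell, G. Henniart, *The Local Langlands Conjecture for GL(2)*, Grundlehren 335 (2006), §1.1, §2 (Schur's lemma, semisimplicity bookkeeping).
-/

set_option autoImplicit false

namespace Literature.RepresentationTheory

open Function Representation

variable {k : Type*} [Field k] {G : Type*} [Group G] {V : Type*} [AddCommGroup V] [Module k V] (ρ : Representation k G V)

/-! ## §0 Between inequivalent irreducibles every intertwiner vanishes -/

/-- **No equivalence between irreducibles ⇒ `Hom_G = 0`**: an intertwiner between irreducible representations is bijective or zero (Mathlib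
`Representation.IsIrreducible.bijective_or_eq_zero`); a bijective one is an equivalence. [cite: BushnellHenniart2006, §1.1] -/
theorem intertwiningMap_eq_zero_of_forall_equiv_false {W W' : Type*} [AddCommGroup W] [Module k W] [AddCommGroup W'] [Module k W']
    {σ : Representation k G W} {σ' : Representation k G W'} [σ.IsIrreducible] [σ'.IsIrreducible] (h : ∀ e : σ.Equiv σ', False)
    (ψ : σ.IntertwiningMap σ') : ψ = 0 := by
  rcases Representation.IsIrreducible.bijective_or_eq_zero ψ with hb | h0
  · exact (h (ψ.ofBijective hb)).elim
  · exact h0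

/-! ## §1 The direct sum -/

section Compl

variable {A A' : Submodule k V} (hA : ∀ g, A ≤ A.comap (ρ g)) (hA' : ∀ g, A' ≤ A'.comap (ρ g))

include hA hA' in
/-- The intersection of two invariant submodules is invariant. [cite: BushnellHenniart2006, §2] -/
theorem inf_le_comap_of_invariant (g : G) : A ⊓ A' ≤ (A ⊓ A').comap (ρ g) := fun _ hx => ⟨hA g hx.1, hA' g hx.2⟩

include hA hA' in
/-- The sum of two invariant submodules is invariant. [cite: BushnellHenniart2006, §2] -/
theorem sup_le_comap_of_invariant (g : G) : A ⊔ A' ≤ (A ⊔ A').comap (ρ g) := by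
  intro x hx
  rcases Submodule.mem_sup.1 hx with ⟨a, ha, a', ha', rfl⟩
  change ρ g (a + a') ∈ A ⊔ A'
  rw [map_add]
  exact Submodule.add_mem_sup (hA g ha) (hA' g ha')

include hA hA' in
/-- **Two DISTINCT irreducible invariant submodules meet in `0`** (`A ≠ 0`): `A ⊓ A′` is invariant in `A`, so `⊥` or `A`; the latter would put `A` inside `A′`, where it is `⊥`
or `A′`. [cite: BushnellHenniart2006, §2] -/
theorem inf_eq_bot_of_irreducible_of_ne
    (hAirr : ∀ B : Submodule k V, B ≤ A → (∀ g, B ≤ B.comap (ρ g)) → B = ⊥ ∨ B = A)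
    (hA'irr : ∀ B : Submodule k V, B ≤ A' → (∀ g, B ≤ B.comap (ρ g)) → B = ⊥ ∨ B = A')
    (hAne : A ≠ ⊥) (hne : A ≠ A') : A ⊓ A' = ⊥ := by
  rcases hAirr (A ⊓ A') inf_le_left (inf_le_comap_of_invariant ρ hA hA') with h | h
  · exact h
  · have hle : A ≤ A' := (inf_eq_left.1 h)
    rcases hA'irr A hle hA with h' | h'
    · exact absurd h' hAne
    · exact absurd h' hne

include hA hA' in
/-- **Two DISTINCT irreducible invariant submodules of a representation without 3-chains span everything**: `⊥ < A < A ⊔ A′` (as subrepresentations; `A′ ⊄ A` because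
`A′` would then be `⊥` or `A`), so `A ⊔ A′ < ⊤` is excluded by «no 3-chain». [cite: BushnellHenniart2006, §2] [cite: Rogawski1990, §12.2 (3) pp. 173–174] -/
theorem sup_eq_top_of_irreducible_of_forall_not_lt_lt
    (hAirr : ∀ B : Submodule k V, B ≤ A → (∀ g, B ≤ B.comap (ρ g)) → B = ⊥ ∨ B = A)
    (hAne : A ≠ ⊥) (hA'ne : A' ≠ ⊥) (hne : A ≠ A')
    (hlen : ∀ N₁ N₂ : Subrepresentation ρ, ¬ (⊥ < N₁ ∧ N₁ < N₂ ∧ N₂ < ⊤)) : A ⊔ A' = ⊤ := by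
  have hnle : ¬ A' ≤ A := fun hle => by
    rcases hAirr A' hle hA' with h | h
    · exact hA'ne h
    · exact hne h.symm
  by_contra htop
  let N₁ : Subrepresentation ρ := ⟨A, fun g _ hv => hA g hv⟩
  let N₂ : Subrepresentation ρ := ⟨A ⊔ A', fun g _ hv => sup_le_comap_of_invariant ρ hA hA' g hv⟩
  have h1 : (⊥ : Subrepresentation ρ) < N₁ := by
    rw [SetLike.lt_iff_le_and_exists]
    refine ⟨fun x hx => ?_, ?_⟩
    · have hx0 : x = 0 := (Submodule.mem_bot k).1 hx
      rw [hx0]; exact A.zero_mem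
    · obtain ⟨x, hxA, hx0⟩ := Submodule.exists_mem_ne_zero_of_ne_bot hAne
      exact ⟨x, hxA, fun hx => hx0 ((Submodule.mem_bot k).1 hx)⟩
  have h2 : N₁ < N₂ := by
    rw [SetLike.lt_iff_le_and_exists]
    refine ⟨fun x hx => Submodule.mem_sup_left hx, ?_⟩
    obtain ⟨x, hxA', hxA⟩ := Set.not_subset.1 hnle
    exact ⟨x, Submodule.mem_sup_right hxA', hxA⟩
  have h3 : N₂ < (⊤ : Subrepresentation ρ) := by
    rw [SetLike.lt_iff_le_and_exists]
    refine ⟨fun x _ => Submodule.mem_top, ?_⟩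
    by_contra hall
    push Not at hall
    apply htop
    refine eq_top_iff.2 fun x _ => ?_
    exact hall x Submodule.mem_top
  exact hlen N₁ N₂ ⟨h1, h2, h3⟩

include hA hA' in
/-- **THE DIRECT SUM**: two distinct non-zero irreducible invariant submodules of a representation without 3-chains are complementary, `V = A ⊕ A′` — case (3) of
[Rogawski1990, §12.2]: `i_B(θ̃) = π⁺ ⊕ π⁻`. [cite: Rogawski1990, §12.2 (3) pp. 173–174] [cite: BushnellHenniart2006, §2] -/
theorem isCompl_of_irreducible_pair
    (hAirr : ∀ B : Submodule k V, B ≤ A → (∀ g, B ≤ B.comap (ρ g)) → B = ⊥ ∨ B = A)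
    (hA'irr : ∀ B : Submodule k V, B ≤ A' → (∀ g, B ≤ B.comap (ρ g)) → B = ⊥ ∨ B = A')
    (hAne : A ≠ ⊥) (hA'ne : A' ≠ ⊥) (hne : A ≠ A')
    (hlen : ∀ N₁ N₂ : Subrepresentation ρ, ¬ (⊥ < N₁ ∧ N₁ < N₂ ∧ N₂ < ⊤)) : IsCompl A A' :=
  ⟨disjoint_iff.2 (inf_eq_bot_of_irreducible_of_ne ρ hA hA' hAirr hA'irr hAne hne),
    codisjoint_iff.2 (sup_eq_top_of_irreducible_of_forall_not_lt_lt ρ hA hA' hAirr hAne hA'ne hne hlen)⟩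

end Compl

/-! ## §2 The involution -/

section Involution

variable {A A' : Submodule k V} (hA : ∀ g, A ≤ A.comap (ρ g)) (hA' : ∀ g, A' ≤ A'.comap (ρ g)) (h : IsCompl A A')

include hA hA' in
/-- **The projection onto `A` along the invariant complement `A′` commutes with `ρ`.** [cite: BushnellHenniart2006, §2] -/
theorem projection_comm_of_invariant (g : G) (v : V) : A.projection A' h (ρ g v) = ρ g (A.projection A' h v) := by
  have hv := Submodule.projection_add_projection_eq_self h v
  have h1 : ρ g (A.projection A' h v) ∈ A := hA g (Submodule.projection_apply_mem h v)
  have h2 : ρ g (A'.projection A h.symm v) ∈ A' := hA' g (Submodule.projection_apply_mem h.symm v)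
  conv_lhs => rw [← hv, map_add]
  rw [map_add, Submodule.projection_apply_of_mem_left h h1, (Submodule.projection_apply_eq_zero_iff h).2 h2, add_zero]

include hA hA' in
/-- **THE INVOLUTION `𝒜₀ = P_A − P_{A′}`**: for complementary invariant `A, A′` there is `A₀ ∈ End(V)` commuting with every `ρ g`, equal to `+1` on `A` and `−1` on `A′`, with
`A₀² = 1`, and `A₀ v = P_A v − P_{A′} v`. [cite: Keys1984, §4 Thm. 3 p. 120] [cite: Rogawski1990, §12.2 (3) pp. 173–174] -/
theorem exists_involution_of_isCompl :
    ∃ A₀ : Module.End k V, (∀ g, A₀ * ρ g = ρ g * A₀) ∧ (∀ a ∈ A, A₀ a = a) ∧ (∀ a ∈ A', A₀ a = -a) ∧ A₀ * A₀ = 1 ∧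
      ∀ v, A₀ v = A.projection A' h v - A'.projection A h.symm v := by
  refine ⟨A.projection A' h - A'.projection A h.symm, fun g => ?_, fun a ha => ?_, fun a ha => ?_, ?_, fun v => rfl⟩
  · apply LinearMap.ext
    intro v
    rw [Module.End.mul_apply, Module.End.mul_apply, LinearMap.sub_apply, LinearMap.sub_apply, map_sub,
      projection_comm_of_invariant ρ hA hA' h g v, projection_comm_of_invariant ρ hA' hA h.symm g v]
  · rw [LinearMap.sub_apply, Submodule.projection_apply_of_mem_left h ha, (Submodule.projection_apply_eq_zero_iff h.symm).2 ha, sub_zero]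
  · rw [LinearMap.sub_apply, (Submodule.projection_apply_eq_zero_iff h).2 ha, Submodule.projection_apply_of_mem_left h.symm ha, zero_sub]
  · apply LinearMap.ext
    intro v
    have hv := Submodule.projection_add_projection_eq_self h v
    have hP : ∀ x ∈ A, (A.projection A' h - A'.projection A h.symm) x = x := fun x hx => by
      rw [LinearMap.sub_apply, Submodule.projection_apply_of_mem_left h hx, (Submodule.projection_apply_eq_zero_iff h.symm).2 hx, sub_zero]
    have hQ : ∀ x ∈ A', (A.projection A' h - A'.projection A h.symm) x = -x := fun x hx => by
      rw [LinearMap.sub_apply, (Submodule.projection_apply_eq_zero_iff h).2 hx, Submodule.projection_apply_of_mem_left h.symm hx, zero_sub]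
    rw [Module.End.mul_apply, Module.End.one_apply]
    conv_lhs => rw [← hv]
    rw [map_add, hP _ (Submodule.projection_apply_mem h v), hQ _ (Submodule.projection_apply_mem h.symm v), map_add,
      hP _ (Submodule.projection_apply_mem h v), map_neg, hQ _ (Submodule.projection_apply_mem h.symm v), neg_neg, hv]

/-- An endomorphism fixing `A` and negating `A′` IS `P_A − P_{A′}` (uniqueness of the involution of `exists_involution_of_isCompl`). [cite: Keys1984, §4 Thm. 3 p. 120] -/
theorem involution_apply_eq (A₀ : Module.End k V) (hAfix : ∀ a ∈ A, A₀ a = a) (hA'fix : ∀ a ∈ A', A₀ a = -a) (v : V) :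
    A₀ v = A.projection A' h v - A'.projection A h.symm v := by
  have hv := Submodule.projection_add_projection_eq_self h v
  conv_lhs => rw [← hv, map_add]
  rw [hAfix _ (Submodule.projection_apply_mem h v), hA'fix _ (Submodule.projection_apply_mem h.symm v), sub_eq_add_neg]

omit hA hA' h in
/-- The involution is NOT `1` when `A′ ≠ 0` (it negates `A′`; `2 ≠ 0`). [cite: Keys1984, §4 Thm. 3 p. 120] -/
theorem involution_ne_one (A₀ : Module.End k V) (hA'fix : ∀ a ∈ A', A₀ a = -a) (hA'ne : A' ≠ ⊥) (h2 : (2 : k) ≠ 0) : A₀ ≠ 1 := by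
  intro h1
  obtain ⟨x, hx, hx0⟩ := Submodule.exists_mem_ne_zero_of_ne_bot hA'ne
  have hx' : A₀ x = -x := hA'fix x hx
  rw [h1, Module.End.one_apply, eq_neg_iff_add_eq_zero, ← two_smul k x, smul_eq_zero] at hx'
  rcases hx' with h | h
  · exact h2 h
  · exact hx0 h

omit hA hA' h in
/-- The involution is NOT `−1` when `A ≠ 0` (it fixes `A`; `2 ≠ 0`). [cite: Keys1984, §4 Thm. 3 p. 120] -/
theorem involution_ne_neg_one (A₀ : Module.End k V) (hAfix : ∀ a ∈ A, A₀ a = a) (hAne : A ≠ ⊥) (h2 : (2 : k) ≠ 0) : A₀ ≠ -1 := by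
  intro h1
  obtain ⟨x, hx, hx0⟩ := Submodule.exists_mem_ne_zero_of_ne_bot hAne
  have hx' : A₀ x = x := hAfix x hx
  rw [h1, LinearMap.neg_apply, Module.End.one_apply, neg_eq_iff_add_eq_zero, ← two_smul k x, smul_eq_zero] at hx'
  rcases hx' with h | h
  · exact h2 h
  · exact hx0 h

end Involution

/-! ## §3 The commutant `End_G(V) = k·1 ⊕ k·𝒜₀` -/

section Commutant

variable {A A' : Submodule k V} (hA : ∀ g, A ≤ A.comap (ρ g)) (hA' : ∀ g, A' ≤ A'.comap (ρ g)) (h : IsCompl A A')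

include h in
/-- **Schur on the two blocks + vanishing of the two off-diagonal Homs ⇒ every `G`-endomorphism is `a·1 + b·𝒜₀`** (`2 ≠ 0`).  For `T ∈ End_G(V)`: `P_A T|_A ∈ End_G(ρ|_A)`
is a scalar `c` (`hSchurA`), `P_{A′} T|_A ∈ Hom_G(ρ|_A, ρ|_{A′}) = 0` (`hHom`), so `T = c` on `A`; likewise `T = d` on `A′`; hence `T = c P_A + d P_{A′} = ((c+d)∕2)·1 + ((c−d)∕2)·𝒜₀`.
The hypotheses are stated on Mathlib's `IntertwiningMap`s of the sub-representations `ρ.subrepresentation A hA`, `ρ.subrepresentation A' hA'` (the K4′ SENTENCE's currency).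
[cite: Keys1984, §4 Thm. 3 p. 120] [cite: BushnellHenniart2006, §1.1, §2] -/
theorem exists_eq_smul_one_add_smul_involution (A₀ : Module.End k V) (hAfix : ∀ a ∈ A, A₀ a = a) (hA'fix : ∀ a ∈ A', A₀ a = -a)
    (hSchurA : ∀ S : (ρ.subrepresentation A hA).IntertwiningMap (ρ.subrepresentation A hA), ∃ c : k, ∀ a, S a = c • a)
    (hSchurA' : ∀ S : (ρ.subrepresentation A' hA').IntertwiningMap (ρ.subrepresentation A' hA'), ∃ c : k, ∀ a, S a = c • a)
    (hHom : ∀ S : (ρ.subrepresentation A hA).IntertwiningMap (ρ.subrepresentation A' hA'), S = 0)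
    (hHom' : ∀ S : (ρ.subrepresentation A' hA').IntertwiningMap (ρ.subrepresentation A hA), S = 0)
    (h2 : (2 : k) ≠ 0) (T : Module.End k V) (hT : ∀ g, T * ρ g = ρ g * T) :
    ∃ a b : k, T = a • 1 + b • A₀ := by
  -- the four blocks of `T` as intertwiners
  have hTg : ∀ g v, T (ρ g v) = ρ g (T v) := fun g v => by
    have := congrArg (fun f : Module.End k V => f v) (hT g)
    simpa only [Module.End.mul_apply] using this
  have hPc := projection_comm_of_invariant ρ hA hA' h
  have hP'c := projection_comm_of_invariant ρ hA' hA h.symm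
  -- the four blocks of `T`: `A → A` is a scalar `c` (Schur), `A → A′` is `0`, `A′ → A′` is a scalar `d`, `A′ → A` is `0`
  obtain ⟨c, hc⟩ := hSchurA (LinearMap.intertwiningMap_of_isIntertwiningMap _ _ ((A.projectionOnto A' h) ∘ₗ T ∘ₗ A.subtype) (fun g a => by
      apply Subtype.ext
      simp only [LinearMap.comp_apply, Submodule.subtype_apply, Submodule.coe_projectionOnto_apply, Representation.subrepresentation_apply,
        LinearMap.coe_restrict_apply]
      rw [hTg, hPc]))
  have h0 := hHom (LinearMap.intertwiningMap_of_isIntertwiningMap _ _ ((A'.projectionOnto A h.symm) ∘ₗ T ∘ₗ A.subtype) (fun g a => by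
      apply Subtype.ext
      simp only [LinearMap.comp_apply, Submodule.subtype_apply, Submodule.coe_projectionOnto_apply, Representation.subrepresentation_apply,
        LinearMap.coe_restrict_apply]
      rw [hTg, hP'c]))
  obtain ⟨d, hd⟩ := hSchurA' (LinearMap.intertwiningMap_of_isIntertwiningMap _ _ ((A'.projectionOnto A h.symm) ∘ₗ T ∘ₗ A'.subtype) (fun g a => by
      apply Subtype.ext
      simp only [LinearMap.comp_apply, Submodule.subtype_apply, Submodule.coe_projectionOnto_apply, Representation.subrepresentation_apply,
        LinearMap.coe_restrict_apply]
      rw [hTg, hP'c]))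
  have h0' := hHom' (LinearMap.intertwiningMap_of_isIntertwiningMap _ _ ((A.projectionOnto A' h) ∘ₗ T ∘ₗ A'.subtype) (fun g a => by
      apply Subtype.ext
      simp only [LinearMap.comp_apply, Submodule.subtype_apply, Submodule.coe_projectionOnto_apply, Representation.subrepresentation_apply,
        LinearMap.coe_restrict_apply]
      rw [hTg, hPc]))
  -- `T a = c a` on `A`, `T a′ = d a′` on `A′`
  have hTA : ∀ a ∈ A, T a = c • a := fun a ha => by
    have e1 : A.projection A' h (T a) = c • a := by
      have := congrArg (fun x : A => (x : V)) (hc ⟨a, ha⟩)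
      simpa only [LinearMap.toIntertwiningMap, LinearMap.comp_apply, Submodule.subtype_apply, Submodule.coe_projectionOnto_apply,
        Submodule.coe_smul] using this
    have e2 : A'.projection A h.symm (T a) = 0 := by
      have := congrArg (fun x : A' => (x : V)) (DFunLike.congr_fun h0 ⟨a, ha⟩)
      simpa only [LinearMap.toIntertwiningMap, LinearMap.comp_apply, Submodule.subtype_apply, Submodule.coe_projectionOnto_apply,
        Representation.IntertwiningMap.coe_zero, Pi.zero_apply, Submodule.coe_zero] using this
    rw [← Submodule.projection_add_projection_eq_self h (T a), e1, e2, add_zero]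
  have hTA' : ∀ a ∈ A', T a = d • a := fun a ha => by
    have e1 : A'.projection A h.symm (T a) = d • a := by
      have := congrArg (fun x : A' => (x : V)) (hd ⟨a, ha⟩)
      simpa only [LinearMap.toIntertwiningMap, LinearMap.comp_apply, Submodule.subtype_apply, Submodule.coe_projectionOnto_apply,
        Submodule.coe_smul] using this
    have e2 : A.projection A' h (T a) = 0 := by
      have := congrArg (fun x : A => (x : V)) (DFunLike.congr_fun h0' ⟨a, ha⟩)
      simpa only [LinearMap.toIntertwiningMap, LinearMap.comp_apply, Submodule.subtype_apply, Submodule.coe_projectionOnto_apply,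
        Representation.IntertwiningMap.coe_zero, Pi.zero_apply, Submodule.coe_zero] using this
    rw [← Submodule.projection_add_projection_eq_self h (T a), e1, e2, zero_add]
  -- assemble: `T = c P_A + d P_{A′} = ((c+d)/2)·1 + ((c−d)/2)·𝒜₀`
  have hs1 : (c + d) / 2 + (c - d) / 2 = c := by
    rw [← add_div, show c + d + (c - d) = 2 * c by ring, mul_div_cancel_left₀ c h2]
  have hs2 : (c + d) / 2 - (c - d) / 2 = d := by
    rw [← sub_div, show c + d - (c - d) = 2 * d by ring, mul_div_cancel_left₀ d h2]
  refine ⟨(c + d) / 2, (c - d) / 2, LinearMap.ext fun v => ?_⟩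
  have hv := Submodule.projection_add_projection_eq_self h v
  have key : T v = c • A.projection A' h v + d • A'.projection A h.symm v := by
    conv_lhs => rw [← hv]
    rw [map_add, hTA _ (Submodule.projection_apply_mem h v), hTA' _ (Submodule.projection_apply_mem h.symm v)]
  rw [LinearMap.add_apply, LinearMap.smul_apply, LinearMap.smul_apply, Module.End.one_apply,
    involution_apply_eq h A₀ hAfix hA'fix v, key]
  conv_rhs => arg 1; rw [← hv]
  rw [smul_add, smul_sub]
  calc c • A.projection A' h v + d • A'.projection A h.symm v
      = ((c + d) / 2 + (c - d) / 2) • A.projection A' h v + ((c + d) / 2 - (c - d) / 2) • A'.projection A h.symm v := by rw [hs1, hs2]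
    _ = ((c + d) / 2) • A.projection A' h v + ((c + d) / 2) • A'.projection A h.symm v +
          (((c - d) / 2) • A.projection A' h v - ((c - d) / 2) • A'.projection A h.symm v) := by
        rw [add_smul, sub_smul]; abel

end Commutant

end Literature.RepresentationTheory
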